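import Mathlib
import Literature.MathematicalPhysics.QuantumFieldTheory.BalabanImbrieJaffe1984to88.BIJ85Eq7112FibreEnergy

/-!
# `BalabanImbrieJaffe1984to88.BIJ85Eq7112FibreMin` — T. Bałaban, J. Imbrie, A. Jaffe, *Renormalization of the Higgs model:
minimizers, propagators and the stability of mean field theory*, Commun. Math. Phys. **97** (1985) 299–329 [BalabanImbrieJaffe1985]:
Sect. 4.2 p. 310 (4.2.1) with Sect. 7.1 pp. 321–322 (7.1.2)/(7.1.12) — **THE CONSTRAINED INFIMUM OF THE EXPONENT OF (4.2.1) SPLITS OVER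
THE UNIT MOMENTA**: on the tori, for the CONCRETE operators `∂^η = n·curlC`, `Q^{e*}_k = edgeAdjC`, `Q_k = B5Block118.QvOp` (gen 5's
`BIJ85Eq7112FibreEnergy`), `inf {‖∂^ηA − Q^{e*}_kf‖²_η : Q_kA = 0} = Σ_{p′} m_{p′}(f̂(p′))` with the FIBRE MINIMUM
`m_{p′}(φ) = inf {E_{p′}(α, φ) : Σ_l u v_μ α_l(μ) = 0 ∀ μ}` of gen 5's fibre energy — the variational content of *"σ_k as a multiplication
operator σ_k(p) in the Fourier transform representation"* (p. 321) for the σ_k DEFINED by (4.2.1)/(7.1.12) (whose Gaussian integral is the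
minimum of its exponent, seats p09/p30/p33 `BIJ85SigmaForm421`/`BIJ85Sigma421Torus`/`BIJ85SigmaVariational`) — file 1 of 4 of the
(7.1.12) = (7.1.13) identification for the σ_k of record (file 2 `BIJ85Eq7112FibreMinReal`: the problem splits into real and imaginary
parts; file 3 `BIJ85Eq7112SymbolFibreMin`: the momentum symbol of the torus σ_k IS `½·m_{p′}`; file 4 `BIJ85Eq7113SymbolIdentification`:
`= τ₁(p′) + τ₂(p′)` at generic momenta)

statement-level skeleton of published theorems with citation tags; proofs where landed; nothing here is a claim about
the Yang–Mills mass gap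

PDF held: `paper:balaban1985-cmp97-bij-higgs-minimizers` (journal page = PDF page + 298).  Text read as images: PDF p. 12 (journal 310;
`run/shared/lean/pub/pub-balaban/t4/b2b-balaban-t4-lit2/renders/bij1985/1985-cmp97-bij-higgs-minimizers-p012-x2.png`), PDF pp. 23–24
(journal 321–322; `…-p023-x2.png`, `…-p024-x2.png`).

THE PRINTED TEXT (verbatim).  p. 310: *"exp(−½⟨f, σ_kf⟩) = Z_{k,Ax}^{−1}∫𝒟Aδ(Q_kA)δ_{k,Ax}(A)exp(−½‖∂A − Q^{e*}_kf‖²). (4.2.1)"*; p. 321: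
*"Since we study periodic boundary conditions, σ_k is translation invariant. Thus it is natural to study σ_k as a multiplication operator
σ_k(p) in the Fourier transform representation. … ⟨f^{(k)}, σ_kf^{(k)}⟩ = ∫⟨f̃(p), σ_k(p)f̃(p)⟩dp, (7.1.2)"*; p. 322: *"The basic object we
wish to study is σ_k, defined in (4.2.2), σ_k = Q^e_k(I − ∂G_{k,Ax}∂^*)Q^{e*}_k. (7.1.12) … Starting from this expression, one can derive
the following formulas for σ_k(p) by straightforward, algebraic manipulation: We express σ_k as a sum of two terms σ_k = τ₁ + τ₂. (7.1.13)"*.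

CITATION HEADER (lean-in-tree rule).  Part of the lit-balaban TYPED SKELETON (HOME `run/shared/lean/pub/lit-balaban/`), Phase-2 seat p27
(gen 6), unit `lit-balaban-p27`; rows **C1.Eq7.1.2-7.1.12**, **C1.Eq7.1.13-7.1.19**, **C1.Thm7.1.1** of `HOME/SKELETON.md` (owner r15,
referee ref-5) — the IDENTIFICATION member recorded NOT CLAIMED in `HOME/lit-balaban-r15/ROWS-C1.md` v1.35 (*"the (7.1.13) identification
with Q^e_k(I − ∂G_{k,Ax}∂^*)Q^{e*}_k"*; p33's `BIJ85Tau1Config717` scope note).  Builds on gen 5's `BIJ85Eq7112FibreEnergy` (`fibreEnergy`,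
`FibreConstraint`, `energy_eq_sum_fibreEnergy`, `QvOp_eq_zero_iff`, `fibreConstraint_smul_iff`) — consumed read-only, as seat p10 gen 5
does for its all-`n` duality files; no overlap with `BIJ85Fibre*`.
TYPED READING (as in gen 5): η-torus `Tor (fine n M)`, unit torus `Tor M`, `F⊗1 = dftC`, cosets `p′ + l ↔ pOf n M (l, p′)`; η-bond fields
`A : Tor (fine n M) × Fin d → ℂ`, unit plaquette fields `f : Tor M × (Fin d × Fin d) → ℂ`; the exponent of (4.2.1) in the physical
normalisation `energy421 n M A f = η^d·Σ_b|(n·curlC A − edgeAdjC f)(b)|²`; `c = cQ n M = n^{−d/2}`.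
WHAT IS KERNEL-CHECKED (zero `sorry`, standard axioms; two objects DEFINED with bodies — `fibreMin`, `energy421` — plus the bookkeeping
`assemble`; no `def … : Prop`, no new named fact, D-0026): §1 `fibreMin` with `fibreMin_le`, `le_fibreMin_iff`,
`exists_fibreEnergy_lt`, `fibreMin_zero`; §2 **`sum_fibreMin_le_energy421`** (every constrained `A` pays at least `Σ_{p′}m_{p′}(f̂(p′))`),
`assemble` (an η-field with PRESCRIBED constrained fibre families, `dftC_assemble`, `assemble_constraint`, `energy421_assemble`),
**`exists_energy421_lt`**, **`iInf_energy421_eq_sum_fibreMin`** (`inf_{Q_kA=0} energy421 A f = Σ_{p′} fibreMin p′ (f̂ p′)`),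
`le_sum_fibreMin_iff`.  NOT CLAIMED here: anything on the `Setup` carriers (file 3), the closed form (7.1.13)–(7.1.16) of the fibre
minimum (file 4 / seat p10), attainment of the infima (not needed).
-/

namespace Literature.MathematicalPhysics.QuantumFieldTheory.BalabanImbrieJaffe1984to88.BIJ85Eq7112FibreMin

open scoped BigOperators Matrix ComplexConjugate
open Literature.MathematicalPhysics.QuantumFieldTheory.Balaban1983to89
open Literature.MathematicalPhysics.QuantumFieldTheory.Balaban1983to89.B5Prop11Plancherel
open Literature.MathematicalPhysics.QuantumFieldTheory.Balaban1983to89.B5Prop11Fiber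
open Literature.MathematicalPhysics.QuantumFieldTheory.Balaban1983to89.B5Block118
open Literature.MathematicalPhysics.QuantumFieldTheory.BalabanImbrieJaffe1984to88.BIJ85Eq712Plancherel
open Literature.MathematicalPhysics.QuantumFieldTheory.BalabanImbrieJaffe1984to88.BIJ85Eq715ConfigSymbols
open Literature.MathematicalPhysics.QuantumFieldTheory.BalabanImbrieJaffe1984to88.BIJ85Eq7111CrossSymbols
open Literature.MathematicalPhysics.QuantumFieldTheory.BalabanImbrieJaffe1984to88.BIJ85Eq7111EdgeAverage
open Literature.MathematicalPhysics.QuantumFieldTheory.BalabanImbrieJaffe1984to88.BIJ85Eq7111EdgeAdjoint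
open Literature.MathematicalPhysics.QuantumFieldTheory.BalabanImbrieJaffe1984to88.BIJ85Eq7112FibreEnergy

noncomputable section

variable {d : ℕ} (n : ℕ) [NeZero n] (M : Fin d → ℕ) [hM : ∀ μ, NeZero (M μ)]

/-! ## §1 The fibre minimum `m_{p′}(φ) = inf {E_{p′}(α, φ) : α constrained}` -/

section FibreMin

omit [NeZero n] hM in
/-- The zero fibre family satisfies the fibre constraint `Σ_l u v_μ α_l(μ) = 0`. [cite: BalabanImbrieJaffe1985, (4.2.1) p.310] -/
theorem fibreConstraint_zero (q : Tor M) : FibreConstraint n M q (fun _ _ => 0) := by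
  intro μ
  simp

omit hM in
/-- The fibre energy is non-negative. [cite: BalabanImbrieJaffe1985, (7.1.12) p.322] -/
theorem fibreEnergy_nonneg (q : Tor M) (α : (Fin d → Fin n) → Fin d → ℂ) (φ : Fin d × Fin d → ℂ) :
    0 ≤ fibreEnergy n M q α φ := by
  unfold fibreEnergy
  positivity

omit hM in
/-- The fibre energy of the zero family against the zero two-form vanishes. [cite: BalabanImbrieJaffe1985, (7.1.12) p.322] -/
theorem fibreEnergy_zero_zero (q : Tor M) : fibreEnergy n M q (fun _ _ => 0) 0 = 0 := by
  simp [fibreEnergy]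

/-- **THE FIBRE MINIMUM at the unit momentum `p′`**: `m_{p′}(φ) = inf {E_{p′}(α, φ) : Σ_l u(p′+l)v_μ(p′+l)α_l(μ) = 0 ∀ μ}` — the fibre at `p′`
of the constrained minimum of the exponent `‖∂A − Q^{e*}_kf‖²` of (4.2.1), i.e. (up to the factor 2 of the ordered-pair convention) the form
`⟨φ, σ_k(p′)φ⟩` of the multiplication operator of (7.1.2)/(7.1.12) (files 2–3). [cite: BalabanImbrieJaffe1985, (7.1.12) p.322] -/
def fibreMin (q : Tor M) (φ : Fin d × Fin d → ℂ) : ℝ :=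
  ⨅ α : {α : (Fin d → Fin n) → Fin d → ℂ // FibreConstraint n M q α}, fibreEnergy n M q α.1 φ

omit [NeZero n] hM in
/-- kernel: the constraint set is inhabited (by zero). [folklore] -/
private theorem nonempty_constr (q : Tor M) : Nonempty {α : (Fin d → Fin n) → Fin d → ℂ // FibreConstraint n M q α} :=
  ⟨⟨fun _ _ => 0, fibreConstraint_zero n M q⟩⟩

omit hM in
/-- kernel: the fibre energies of constrained families are bounded below (by zero). [folklore] -/
private theorem bddBelow_constr (q : Tor M) (φ : Fin d × Fin d → ℂ) :
    BddBelow (Set.range fun β : {α : (Fin d → Fin n) → Fin d → ℂ // FibreConstraint n M q α} => fibreEnergy n M q β.1 φ) := by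
  refine ⟨0, ?_⟩
  rintro _ ⟨β, rfl⟩
  exact fibreEnergy_nonneg n M q β.1 φ

omit hM in
/-- `m_{p′}(φ) ≤ E_{p′}(α, φ)` for every constrained family `α`. [cite: BalabanImbrieJaffe1985, (7.1.12) p.322] -/
theorem fibreMin_le {q : Tor M} {α : (Fin d → Fin n) → Fin d → ℂ} (hα : FibreConstraint n M q α) (φ : Fin d × Fin d → ℂ) :
    fibreMin n M q φ ≤ fibreEnergy n M q α φ :=
  ciInf_le (bddBelow_constr n M q φ) ⟨α, hα⟩

omit hM in
/-- Transfer of lower bounds: `a ≤ m_{p′}(φ)` iff `a ≤ E_{p′}(α, φ)` for every constrained `α`. [cite: BalabanImbrieJaffe1985, (7.1.22) p.324] -/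
theorem le_fibreMin_iff {q : Tor M} {φ : Fin d × Fin d → ℂ} {a : ℝ} :
    a ≤ fibreMin n M q φ ↔ ∀ α : (Fin d → Fin n) → Fin d → ℂ, FibreConstraint n M q α → a ≤ fibreEnergy n M q α φ := by
  haveI := nonempty_constr n M q
  refine ⟨fun h α hα => h.trans (fibreMin_le n M hα φ), fun h => le_ciInf fun β => h β.1 β.2⟩

omit hM in
/-- `0 ≤ m_{p′}(φ)`. [cite: BalabanImbrieJaffe1985, (7.1.12) p.322] -/
theorem fibreMin_nonneg (q : Tor M) (φ : Fin d × Fin d → ℂ) : 0 ≤ fibreMin n M q φ :=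
  (le_fibreMin_iff n M).2 fun α _ => fibreEnergy_nonneg n M q α φ

omit hM in
/-- Near-minimisers: for every `ε > 0` some constrained `α` has `E_{p′}(α, φ) < m_{p′}(φ) + ε`. [cite: BalabanImbrieJaffe1985, (7.1.12) p.322] -/
theorem exists_fibreEnergy_lt (q : Tor M) (φ : Fin d × Fin d → ℂ) {ε : ℝ} (hε : 0 < ε) :
    ∃ α : (Fin d → Fin n) → Fin d → ℂ, FibreConstraint n M q α ∧ fibreEnergy n M q α φ < fibreMin n M q φ + ε := by
  haveI := nonempty_constr n M q
  obtain ⟨β, hβ⟩ := exists_lt_of_ciInf_lt (lt_add_of_pos_right (fibreMin n M q φ) hε)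
  exact ⟨β.1, β.2, hβ⟩

omit hM in
/-- `m_{p′}(0) = 0` (the zero family is constrained and costs nothing). [cite: BalabanImbrieJaffe1985, (7.1.12) p.322] -/
theorem fibreMin_zero (q : Tor M) : fibreMin n M q 0 = 0 :=
  le_antisymm ((fibreMin_le n M (fibreConstraint_zero n M q) 0).trans_eq (fibreEnergy_zero_zero n M q)) (fibreMin_nonneg n M q 0)

end FibreMin

/-! ## §2 The exponent of (4.2.1) and the splitting of its constrained infimum over the unit momenta -/

section Energy

/-- **The exponent of (4.2.1) on the tori, physical normalisation**: `‖∂^ηA − Q^{e*}_kf‖²_η = η^d·Σ_b|(n·curlC A − edgeAdjC f)(b)|²`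
(`η = 1/n`; the left member of gen 5's `energy_eq_sum_fibreEnergy`, the right member of p10's `thm711_configSpace`).
[cite: BalabanImbrieJaffe1985, (4.2.1) p.310] -/
def energy421 (A : Tor (fine n M) × Fin d → ℂ) (f : Tor M × (Fin d × Fin d) → ℂ) : ℝ :=
  ((n : ℝ) ^ d)⁻¹ * ∑ b, ‖((n : ℂ) • (curlC (fine n M) *ᵥ A) - edgeAdjC n M *ᵥ f) b‖ ^ 2

/-- `energy421` unfolded. [cite: BalabanImbrieJaffe1985, (4.2.1) p.310] -/
theorem energy421_def (A : Tor (fine n M) × Fin d → ℂ) (f : Tor M × (Fin d × Fin d) → ℂ) :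
    energy421 n M A f = ((n : ℝ) ^ d)⁻¹ * ∑ b, ‖((n : ℂ) • (curlC (fine n M) *ᵥ A) - edgeAdjC n M *ᵥ f) b‖ ^ 2 := rfl

/-- The exponent is non-negative. [cite: BalabanImbrieJaffe1985, (4.2.1) p.310] -/
theorem energy421_nonneg (A : Tor (fine n M) × Fin d → ℂ) (f : Tor M × (Fin d × Fin d) → ℂ) : 0 ≤ energy421 n M A f := by
  unfold energy421
  positivity

/-- kernel: `c = n^{−d/2} ≠ 0` in `ℂ`. [folklore] -/
private theorem cQ_ne_zero' : (cQ n M : ℂ) ≠ 0 := by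
  have hn : (0 : ℝ) < (n : ℝ) ^ d := pow_pos (by exact_mod_cast Nat.pos_of_ne_zero (NeZero.ne n)) d
  rw [cQ_eq]
  exact_mod_cast (inv_pos.mpr (Real.sqrt_pos.mpr hn)).ne'

/-- gen 5's split, restated for `energy421`: `energy421 A f = Σ_{p′} E_{p′}((c·Â(p′+l))_l, f̂(p′))`. [cite: BalabanImbrieJaffe1985, (7.1.12) p.322] -/
theorem energy421_eq_sum_fibreEnergy (A : Tor (fine n M) × Fin d → ℂ) (f : Tor M × (Fin d × Fin d) → ℂ) :
    energy421 n M A f = ∑ q : Tor M, fibreEnergy n M q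
      (fun k i => (cQ n M : ℂ) * (dftC (fine n M) (Fin d) *ᵥ A) (pOf n M (k, q), i))
      (fun a => (dftC M (Fin d × Fin d) *ᵥ f) (q, a)) :=
  energy_eq_sum_fibreEnergy n M A f

/-- **Every constrained `A` pays at least the sum of the fibre minima**: `Q_kA = 0 ⟹ Σ_{p′} m_{p′}(f̂(p′)) ≤ ‖∂^ηA − Q^{e*}_kf‖²_η`.
[cite: BalabanImbrieJaffe1985, (7.1.12) p.322] -/
theorem sum_fibreMin_le_energy421 {A : Tor (fine n M) × Fin d → ℂ} (hA : QvOp n M *ᵥ A = 0) (f : Tor M × (Fin d × Fin d) → ℂ) :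
    ∑ q : Tor M, fibreMin n M q (fun a => (dftC M (Fin d × Fin d) *ᵥ f) (q, a)) ≤ energy421 n M A f := by
  rw [energy421_eq_sum_fibreEnergy]
  refine Finset.sum_le_sum fun q _ => fibreMin_le n M ?_ _
  rw [fibreConstraint_smul_iff n M q _ (cQ_ne_zero' n M)]
  exact (QvOp_eq_zero_iff n M A).1 hA q

/-- **The η-bond field with PRESCRIBED fibre families**: `Â(p′+l)_i = c^{−1}·α_{p′}(l)(i)` (inverse transform of the family placed on the
cosets). [cite: BalabanImbrieJaffe1985, (7.1.12) p.322] -/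
def assemble (α : Tor M → (Fin d → Fin n) → Fin d → ℂ) : Tor (fine n M) × Fin d → ℂ :=
  star (dftC (fine n M) (Fin d)) *ᵥ fun b => ((cQ n M : ℂ))⁻¹ * α (kqOf n M b.1).2 (kqOf n M b.1).1 b.2

/-- The transform of `assemble α` on the coset of `p′`: `(F⊗1)(assemble α)(p′+l)_i = c^{−1}α_{p′}(l)(i)`. [cite: BalabanImbrieJaffe1985, (7.1.12) p.322] -/
theorem dftC_assemble (α : Tor M → (Fin d → Fin n) → Fin d → ℂ) (k : Fin d → Fin n) (q : Tor M) (i : Fin d) :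
    (dftC (fine n M) (Fin d) *ᵥ assemble n M α) (pOf n M (k, q), i) = ((cQ n M : ℂ))⁻¹ * α q k i := by
  rw [assemble, Matrix.mulVec_mulVec, dftC_mul_star, Matrix.one_mulVec, kqOf_pOf]

/-- … so its fibre families are exactly `α`: `c·(F⊗1)(assemble α)(p′+l) = α_{p′}(l)`. [cite: BalabanImbrieJaffe1985, (7.1.12) p.322] -/
theorem cQ_mul_dftC_assemble (α : Tor M → (Fin d → Fin n) → Fin d → ℂ) (k : Fin d → Fin n) (q : Tor M) (i : Fin d) :
    (cQ n M : ℂ) * (dftC (fine n M) (Fin d) *ᵥ assemble n M α) (pOf n M (k, q), i) = α q k i := by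
  rw [dftC_assemble, ← mul_assoc, mul_inv_cancel₀ (cQ_ne_zero' n M), one_mul]

/-- **`assemble α` satisfies `Q_kA = 0` when every fibre family is constrained.** [cite: BalabanImbrieJaffe1985, (4.2.1) p.310] -/
theorem assemble_constraint {α : Tor M → (Fin d → Fin n) → Fin d → ℂ} (hα : ∀ q, FibreConstraint n M q (α q)) :
    QvOp n M *ᵥ assemble n M α = 0 := by
  rw [QvOp_eq_zero_iff]
  intro q
  have h : (fun k i => (dftC (fine n M) (Fin d) *ᵥ assemble n M α) (pOf n M (k, q), i)) = fun k i => ((cQ n M : ℂ))⁻¹ * α q k i := by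
    funext k i
    exact dftC_assemble n M α k q i
  rw [h, fibreConstraint_smul_iff n M q _ (inv_ne_zero (cQ_ne_zero' n M))]
  exact hα q

/-- **The energy of `assemble α` is the sum of the fibre energies of the families `α_{p′}`.** [cite: BalabanImbrieJaffe1985, (7.1.12) p.322] -/
theorem energy421_assemble (α : Tor M → (Fin d → Fin n) → Fin d → ℂ) (f : Tor M × (Fin d × Fin d) → ℂ) :
    energy421 n M (assemble n M α) f = ∑ q : Tor M, fibreEnergy n M q (α q) (fun a => (dftC M (Fin d × Fin d) *ᵥ f) (q, a)) := by
  rw [energy421_eq_sum_fibreEnergy]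
  refine Finset.sum_congr rfl fun q _ => ?_
  have h : (fun k i => (cQ n M : ℂ) * (dftC (fine n M) (Fin d) *ᵥ assemble n M α) (pOf n M (k, q), i)) = α q := by
    funext k i
    exact cQ_mul_dftC_assemble n M α k q i
  rw [h]

/-- **Near-minimisers in configuration space**: for every `ε > 0` there is a constrained η-bond field `A` with
`‖∂^ηA − Q^{e*}_kf‖²_η < Σ_{p′} m_{p′}(f̂(p′)) + ε` (assemble fibrewise near-minimisers). [cite: BalabanImbrieJaffe1985, (7.1.12) p.322] -/
theorem exists_energy421_lt (f : Tor M × (Fin d × Fin d) → ℂ) {ε : ℝ} (hε : 0 < ε) :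
    ∃ A : Tor (fine n M) × Fin d → ℂ, QvOp n M *ᵥ A = 0 ∧
      energy421 n M A f < ∑ q : Tor M, fibreMin n M q (fun a => (dftC M (Fin d × Fin d) *ᵥ f) (q, a)) + ε := by
  have hcard : (0 : ℝ) < Fintype.card (Tor M) := Nat.cast_pos.2 Fintype.card_pos
  have hδ : 0 < ε / Fintype.card (Tor M) := div_pos hε hcard
  have hex : ∀ q : Tor M, ∃ α : (Fin d → Fin n) → Fin d → ℂ, FibreConstraint n M q α ∧
      fibreEnergy n M q α (fun a => (dftC M (Fin d × Fin d) *ᵥ f) (q, a))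
        < fibreMin n M q (fun a => (dftC M (Fin d × Fin d) *ᵥ f) (q, a)) + ε / Fintype.card (Tor M) := fun q =>
    exists_fibreEnergy_lt n M q (fun a => (dftC M (Fin d × Fin d) *ᵥ f) (q, a)) hδ
  choose α hαc hαlt using hex
  refine ⟨assemble n M α, assemble_constraint n M hαc, ?_⟩
  rw [energy421_assemble]
  calc ∑ q : Tor M, fibreEnergy n M q (α q) (fun a => (dftC M (Fin d × Fin d) *ᵥ f) (q, a))
      < ∑ q : Tor M, (fibreMin n M q (fun a => (dftC M (Fin d × Fin d) *ᵥ f) (q, a)) + ε / Fintype.card (Tor M)) :=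
        Finset.sum_lt_sum_of_nonempty Finset.univ_nonempty fun q _ => hαlt q
    _ = ∑ q : Tor M, fibreMin n M q (fun a => (dftC M (Fin d × Fin d) *ᵥ f) (q, a)) + ε := by
        rw [Finset.sum_add_distrib, Finset.sum_const, Finset.card_univ, nsmul_eq_mul, mul_div_cancel₀ _ hcard.ne']

/-- kernel: the constrained η-fields are inhabited (by zero). [folklore] -/
private theorem nonempty_constrA : Nonempty {A : Tor (fine n M) × Fin d → ℂ // QvOp n M *ᵥ A = 0} :=
  ⟨⟨0, Matrix.mulVec_zero _⟩⟩

/-- kernel: constrained energies are bounded below (by zero). [folklore] -/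
private theorem bddBelow_constrA (f : Tor M × (Fin d × Fin d) → ℂ) :
    BddBelow (Set.range fun B : {A : Tor (fine n M) × Fin d → ℂ // QvOp n M *ᵥ A = 0} => energy421 n M B.1 f) := by
  refine ⟨0, ?_⟩
  rintro _ ⟨B, rfl⟩
  exact energy421_nonneg n M B.1 f

/-- `inf_{Q_kA=0} ‖∂^ηA − Q^{e*}_kf‖²_η ≤ ‖∂^ηA − Q^{e*}_kf‖²_η` for each constrained `A`. [cite: BalabanImbrieJaffe1985, (4.2.1) p.310] -/
theorem iInf_energy421_le {A : Tor (fine n M) × Fin d → ℂ} (hA : QvOp n M *ᵥ A = 0) (f : Tor M × (Fin d × Fin d) → ℂ) :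
    (⨅ B : {A : Tor (fine n M) × Fin d → ℂ // QvOp n M *ᵥ A = 0}, energy421 n M B.1 f) ≤ energy421 n M A f :=
  ciInf_le (bddBelow_constrA n M f) ⟨A, hA⟩

/-- **THE CONSTRAINED INFIMUM OF THE EXPONENT OF (4.2.1) SPLITS OVER THE UNIT MOMENTA**:
`inf {‖∂^ηA − Q^{e*}_kf‖²_η : Q_kA = 0} = Σ_{p′} m_{p′}(f̂(p′))` — the variational form of *"σ_k as a multiplication operator σ_k(p)"*
for the σ_k of (4.2.1)/(7.1.12), every block size `n`, every torus. [cite: BalabanImbrieJaffe1985, (7.1.12) p.322] -/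
theorem iInf_energy421_eq_sum_fibreMin (f : Tor M × (Fin d × Fin d) → ℂ) :
    (⨅ B : {A : Tor (fine n M) × Fin d → ℂ // QvOp n M *ᵥ A = 0}, energy421 n M B.1 f)
      = ∑ q : Tor M, fibreMin n M q (fun a => (dftC M (Fin d × Fin d) *ᵥ f) (q, a)) := by
  haveI := nonempty_constrA n M
  refine le_antisymm (le_of_forall_pos_lt_add fun ε hε => ?_) (le_ciInf fun B => sum_fibreMin_le_energy421 n M B.2 f)
  obtain ⟨A, hA, hlt⟩ := exists_energy421_lt n M f hε
  exact (iInf_energy421_le n M hA f).trans_lt hlt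

/-- Transfer of lower bounds: `a ≤ Σ_{p′} m_{p′}(f̂(p′))` iff `a ≤ ‖∂^ηA − Q^{e*}_kf‖²_η` for every constrained `A`.
[cite: BalabanImbrieJaffe1985, (7.1.22) p.324] -/
theorem le_sum_fibreMin_iff (f : Tor M × (Fin d × Fin d) → ℂ) (a : ℝ) :
    a ≤ ∑ q : Tor M, fibreMin n M q (fun a => (dftC M (Fin d × Fin d) *ᵥ f) (q, a)) ↔
      ∀ A : Tor (fine n M) × Fin d → ℂ, QvOp n M *ᵥ A = 0 → a ≤ energy421 n M A f := by
  haveI := nonempty_constrA n M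
  rw [← iInf_energy421_eq_sum_fibreMin]
  refine ⟨fun h A hA => h.trans (iInf_energy421_le n M hA f), fun h => le_ciInf fun B => h B.1 B.2⟩

end Energy


end

end Literature.MathematicalPhysics.QuantumFieldTheory.BalabanImbrieJaffe1984to88.BIJ85Eq7112FibreMin
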